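/-
Copyright (c) 2026 the pub-hodgecm-mathlib formalisation cell (harness21).  Prover seat hodgecm-mathlib-K2Liu-p11 (g0), Track B «K2-LIT»,
#184♮ = hLiu418 = `stmt-HodgeConjecture-24832`; LEAD F0P6-plan (g12) DEAL 2026-09-04T06:56:46Z ∕ «= ×3» 07:19:04Z, SIGS-RoadI-v3 §Hol
row H1-E (K2E5-plan (g5)), file E-2 of H1-E (REPORT-H1E-CENSUS.K2Liu-p11-g0.md §4).  THEOREMS ONLY (no `def`, no `instance`, no notation,
no named-fact hypothesis, no `sorry`).
-/
import Summits.HodgeConjecture.HodgeConjecture.Theorems.K2LiuHermitianTubeCocycle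
import Mathlib.Analysis.SpecialFunctions.Exponential
import Mathlib.Analysis.Calculus.InverseFunctionTheorem.FDeriv
import Mathlib.Analysis.Calculus.Deriv.Mul
import Mathlib.Analysis.Calculus.Deriv.Pi
import Mathlib.Analysis.Calculus.FDeriv.Analytic
import Mathlib.Analysis.Calculus.ContDiff.Operations
import Mathlib.Analysis.Matrix.Normed
import HarnessLib

/-!
# Crux `HLiu418`, Road I, organ H1-E (hermitian-tube Cauchy–Riemann dictionary), file E-2:
# the exponential `P`-chart of the hermitian tube at a point and its inverse (pure calculus)

Cell `hodgecm-mathlib`, crux item hLiu418 = `stmt-HodgeConjecture-24832` (helper lane `--supports`, count-neutral).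

For the tube `ℌ_n` realised with base point `i·1` and `moeb g Z = (AZ+B)(CZ+D)⁻¹` (★ `SiegelUpperHalfSpace.moeb`), this file supplies the
ANALYSIS of the chart `y ↦ R₀ · moeb (exp (Λ y)) (i·1) · R₀ + X₀` (`Λ : E →L[ℝ] M_{2n}(ℂ)` any real-linear map, `X₀, R₀` any `n × n`
matrices; in E-4, `Λ(b,c) = (c b; 0 −c)` over real coordinates of `Herm_n²` and `transl X₀ · levi R₀` is the ★ H1-B section of `Z₀`):
* §1 the infinitesimal action at the base point, entrywise: `d/dt|₀ moeb (exp tY) (i·1) = Y₁₂ + Y₂₁ + i (Y₁₁ − Y₂₂)`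
  (`hasDerivAt_moeb_exp_smul_entry`; product rule with ★ `hasFDerivAt_ringInverse` at `denom = 1`);
* §2 smoothness of `y ↦ moeb (exp (Λ y)) (i·1)` at `0`, entrywise (`contDiffAt_moeb_exp_entry`; ★ `NormedSpace.exp_analytic`,
  `contDiffAt_ringInverse`);
* §3 the chart `χ(y) = R₀ · moeb (exp (Λ y)) (i·1) · R₀ + X₀` in coordinates `l → l → ℂ` has a STRICT Fréchet derivative at `0` equal to any
  given `A : E ≃L[ℝ] (l → l → ℂ)` whose values are `A y = R₀ ((Λy)₁₂ + (Λy)₂₁ + i((Λy)₁₁ − (Λy)₂₂)) R₀` (`hasStrictFDerivAt_chart`: strictness from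
  §2, the value from §1 along real lines + uniqueness of 1-D derivatives);
* §4 the inverse function theorem packaged (`exists_localInverse_chart`): a local inverse `ψ` with `ψ (χ 0) = 0`, `χ ∘ ψ = id` near `χ 0`,
  `HasFDerivAt ψ A⁻¹ (χ 0)`.
All matrix calculus is done with the `L∞`-operator norm opened INSIDE proofs (`open scoped Matrix.Norms.Operator in`, Mathlib's idiom in
`MatrixExponential`); every exported statement is scalar- or `Pi`-valued (coordinates `l → l → ℂ`, the convention of ★ `K2LiuHolTubeRigidity`),
so no matrix norm leaks.  No group theory is used here: `Y`, `Λ`, `X₀`, `R₀` are arbitrary.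
References: ball-lane template ★ `UnitaryBallCauchyRiemann` (§3–§5 there); [Shimura1997, §§5–6]; [Bump1997, §2.1] (prototype `SL₂(ℝ)`).
HONEST LABEL: HC_CM is proved only modulo the 7 printed citations (2 remaining named inputs: hLiu418 = stmt-HodgeConjecture-24832,
h413 = stmt-HodgeConjecture-24833) until rung 0 closes; count-neutral helper, closes no socket.
-/

set_option autoImplicit false
set_option linter.dupNamespace false

noncomputable section

open scoped Matrix Topology
open Filter Set NormedSpace Complex
open Literature.NumberTheory.ModularForms.SiegelUpperHalfSpace (num denom moeb num_def denom_def moeb_def)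

namespace Summit.HodgeConjecture.HodgeConjecture.Cruxes.HLiu418.K2LiuHermitianTubePChart

variable {l : Type*} [Fintype l] [DecidableEq l]

/-! ## §1 The infinitesimal action at the base point `i·1` -/

/-- `num P (i·1) = i P₁₁ + P₁₂`, `denom P (i·1) = i P₂₁ + P₂₂`. [cite: Shimura1997, §5.1] -/
theorem num_I (P : Matrix (l ⊕ l) (l ⊕ l) ℂ) : num P (I • (1 : Matrix l l ℂ)) = I • P.toBlocks₁₁ + P.toBlocks₁₂ := by
  rw [num_def, Matrix.mul_smul, Matrix.mul_one]

/-- `denom P (i·1) = i P₂₁ + P₂₂`. [cite: Shimura1997, §5.1] -/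
theorem denom_I' (P : Matrix (l ⊕ l) (l ⊕ l) ℂ) : denom P (I • (1 : Matrix l l ℂ)) = I • P.toBlocks₂₁ + P.toBlocks₂₂ := by
  rw [denom_def, Matrix.mul_smul, Matrix.mul_one]

/-- `num 1 (i·1) = i·1`, `denom 1 (i·1) = 1`. [folklore] -/
theorem num_one_I : num (1 : Matrix (l ⊕ l) (l ⊕ l) ℂ) (I • (1 : Matrix l l ℂ)) = I • 1 := by
  rw [num_I, ← Matrix.fromBlocks_one, Matrix.toBlocks_fromBlocks₁₁, Matrix.toBlocks_fromBlocks₁₂, add_zero]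

/-- `denom 1 (i·1) = 1`. [folklore] -/
theorem denom_one_I : denom (1 : Matrix (l ⊕ l) (l ⊕ l) ℂ) (I • (1 : Matrix l l ℂ)) = 1 := by
  rw [denom_I', ← Matrix.fromBlocks_one, Matrix.toBlocks_fromBlocks₂₁, Matrix.toBlocks_fromBlocks₂₂, smul_zero, zero_add]

set_option backward.isDefEq.respectTransparency false in
/-- **Infinitesimal action at the base point** (entrywise): for any `Y ∈ M_{2n}(ℂ)`,
`d/dt|_{t=0} moeb (exp tY) (i·1) = Y₁₂ + Y₂₁ + i (Y₁₁ − Y₂₂)`. [cite: Shimura1997, §5.6] -/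
theorem hasDerivAt_moeb_exp_smul_entry (Y : Matrix (l ⊕ l) (l ⊕ l) ℂ) (i j : l) :
    HasDerivAt (fun t : ℝ => moeb (exp (t • Y)) (I • (1 : Matrix l l ℂ)) i j)
      ((Y.toBlocks₁₂ + Y.toBlocks₂₁ + I • (Y.toBlocks₁₁ - Y.toBlocks₂₂)) i j) 0 := by
  open scoped Matrix.Norms.Operator in
  -- block extraction and entries as continuous linear maps (finite-dimensional bookkeeping)
  have key : HasDerivAt (fun t : ℝ => (Matrix.entryLinearMap ℝ ℂ i j)
      (num (exp (t • Y)) (I • (1 : Matrix l l ℂ)) * Ring.inverse (denom (exp (t • Y)) (I • (1 : Matrix l l ℂ)))))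
      ((Matrix.entryLinearMap ℝ ℂ i j) (Y.toBlocks₁₂ + Y.toBlocks₂₁ + I • (Y.toBlocks₁₁ - Y.toBlocks₂₂))) 0 := by
    set B₁₁ : Matrix (l ⊕ l) (l ⊕ l) ℂ →L[ℝ] Matrix l l ℂ := LinearMap.toContinuousLinearMap
      { toFun := fun M => M.toBlocks₁₁, map_add' := fun _ _ => rfl, map_smul' := fun _ _ => rfl } with hB₁₁
    set B₁₂ : Matrix (l ⊕ l) (l ⊕ l) ℂ →L[ℝ] Matrix l l ℂ := LinearMap.toContinuousLinearMap
      { toFun := fun M => M.toBlocks₁₂, map_add' := fun _ _ => rfl, map_smul' := fun _ _ => rfl } with hB₁₂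
    set B₂₁ : Matrix (l ⊕ l) (l ⊕ l) ℂ →L[ℝ] Matrix l l ℂ := LinearMap.toContinuousLinearMap
      { toFun := fun M => M.toBlocks₂₁, map_add' := fun _ _ => rfl, map_smul' := fun _ _ => rfl } with hB₂₁
    set B₂₂ : Matrix (l ⊕ l) (l ⊕ l) ℂ →L[ℝ] Matrix l l ℂ := LinearMap.toContinuousLinearMap
      { toFun := fun M => M.toBlocks₂₂, map_add' := fun _ _ => rfl, map_smul' := fun _ _ => rfl } with hB₂₂
    -- `t ↦ exp (tY)` has derivative `Y` at `0`
    have he : HasDerivAt (fun t : ℝ => exp (t • Y)) Y 0 := by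
      have h := hasDerivAt_exp_smul_const' (𝕂 := ℝ) Y 0
      rwa [zero_smul, NormedSpace.exp_zero, mul_one] at h
    have he0 : exp ((0 : ℝ) • Y) = 1 := by rw [zero_smul, NormedSpace.exp_zero]
    -- numerator and denominator
    have hnum : HasDerivAt (fun t : ℝ => num (exp (t • Y)) (I • (1 : Matrix l l ℂ)))
        (I • Y.toBlocks₁₁ + Y.toBlocks₁₂) 0 := by
      have h1 : HasDerivAt (fun t : ℝ => B₁₁ (exp (t • Y))) (B₁₁ Y) 0 := B₁₁.hasFDerivAt.comp_hasDerivAt 0 he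
      have h2 : HasDerivAt (fun t : ℝ => B₁₂ (exp (t • Y))) (B₁₂ Y) 0 := B₁₂.hasFDerivAt.comp_hasDerivAt 0 he
      have h := (h1.const_smul I).add h2
      refine h.congr_of_eventuallyEq (Eventually.of_forall fun t => ?_)
      simp only [Pi.add_apply, Pi.smul_apply]
      rw [num_I]; rfl
    have hden : HasDerivAt (fun t : ℝ => denom (exp (t • Y)) (I • (1 : Matrix l l ℂ)))
        (I • Y.toBlocks₂₁ + Y.toBlocks₂₂) 0 := by
      have h1 : HasDerivAt (fun t : ℝ => B₂₁ (exp (t • Y))) (B₂₁ Y) 0 := B₂₁.hasFDerivAt.comp_hasDerivAt 0 he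
      have h2 : HasDerivAt (fun t : ℝ => B₂₂ (exp (t • Y))) (B₂₂ Y) 0 := B₂₂.hasFDerivAt.comp_hasDerivAt 0 he
      have h := (h1.const_smul I).add h2
      refine h.congr_of_eventuallyEq (Eventually.of_forall fun t => ?_)
      simp only [Pi.add_apply, Pi.smul_apply]
      rw [denom_I']; rfl
    have hden0 : denom (exp ((0 : ℝ) • Y)) (I • (1 : Matrix l l ℂ)) = 1 := by rw [he0, denom_one_I]
    have hnum0 : num (exp ((0 : ℝ) • Y)) (I • (1 : Matrix l l ℂ)) = I • 1 := by rw [he0, num_one_I]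
    -- the inverse of the denominator
    have hR : HasFDerivAt (Ring.inverse : Matrix l l ℂ → Matrix l l ℂ)
        (-((ContinuousLinearMap.mulLeftRight ℝ (Matrix l l ℂ)) 1 1))
        (denom (exp ((0 : ℝ) • Y)) (I • (1 : Matrix l l ℂ))) := by
      have h := hasFDerivAt_ringInverse (𝕜 := ℝ) (1 : (Matrix l l ℂ)ˣ)
      rw [inv_one, Units.val_one] at h
      rwa [hden0]
    have hinv : HasDerivAt (fun t : ℝ => Ring.inverse (denom (exp (t • Y)) (I • (1 : Matrix l l ℂ))))
        (-(I • Y.toBlocks₂₁ + Y.toBlocks₂₂)) 0 := by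
      have h := hR.comp_hasDerivAt (0 : ℝ) hden
      refine h.congr_deriv ?_
      rw [neg_apply, ContinuousLinearMap.mulLeftRight_apply, one_mul, mul_one]
    -- product rule
    have hprod := hnum.mul hinv
    rw [hnum0, hden0, Ring.inverse_one] at hprod
    have hval : (I • Y.toBlocks₁₁ + Y.toBlocks₁₂) * (1 : Matrix l l ℂ) + I • (1 : Matrix l l ℂ) * -(I • Y.toBlocks₂₁ + Y.toBlocks₂₂) =
        Y.toBlocks₁₂ + Y.toBlocks₂₁ + I • (Y.toBlocks₁₁ - Y.toBlocks₂₂) := by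
      rw [Matrix.mul_one, Matrix.smul_mul, Matrix.one_mul, smul_neg, smul_add, smul_smul, Complex.I_mul_I, neg_smul, one_smul,
        smul_sub]
      abel
    rw [hval] at hprod
    exact (Matrix.entryLinearMap ℝ ℂ i j).toContinuousLinearMap.hasFDerivAt.comp_hasDerivAt 0 hprod
  refine key.congr_of_eventuallyEq (Eventually.of_forall fun t => ?_)
  show moeb (exp (t • Y)) (I • 1) i j = _
  rw [moeb_def, Matrix.nonsing_inv_eq_ringInverse]
  rfl

/-! ## §2 Smoothness of `y ↦ moeb (exp (Λ y)) (i·1)` at the origin -/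

section Chart

variable {E : Type*} [NormedAddCommGroup E] [NormedSpace ℝ E]

set_option backward.isDefEq.respectTransparency false in
/-- For any real-linear `Λ : E → M_{2n}(ℂ)`, every entry of `y ↦ moeb (exp (Λ y)) (i·1)` is `C^n` at `y = 0` (there `denom = 1` is invertible).
[folklore] -/
theorem contDiffAt_moeb_exp_entry {m : WithTop ℕ∞} (Λ : E →L[ℝ] Matrix (l ⊕ l) (l ⊕ l) ℂ) (i j : l) :
    ContDiffAt ℝ m (fun y : E => moeb (exp (Λ y)) (I • (1 : Matrix l l ℂ)) i j) 0 := by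
  open scoped Matrix.Norms.Operator in
  have key : ContDiffAt ℝ m (fun y : E => (Matrix.entryLinearMap ℝ ℂ i j)
      (num (exp (Λ y)) (I • (1 : Matrix l l ℂ)) * Ring.inverse (denom (exp (Λ y)) (I • (1 : Matrix l l ℂ))))) 0 := by
    set B₁₁ : Matrix (l ⊕ l) (l ⊕ l) ℂ →L[ℝ] Matrix l l ℂ := LinearMap.toContinuousLinearMap
      { toFun := fun M => M.toBlocks₁₁, map_add' := fun _ _ => rfl, map_smul' := fun _ _ => rfl } with hB₁₁
    set B₁₂ : Matrix (l ⊕ l) (l ⊕ l) ℂ →L[ℝ] Matrix l l ℂ := LinearMap.toContinuousLinearMap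
      { toFun := fun M => M.toBlocks₁₂, map_add' := fun _ _ => rfl, map_smul' := fun _ _ => rfl } with hB₁₂
    set B₂₁ : Matrix (l ⊕ l) (l ⊕ l) ℂ →L[ℝ] Matrix l l ℂ := LinearMap.toContinuousLinearMap
      { toFun := fun M => M.toBlocks₂₁, map_add' := fun _ _ => rfl, map_smul' := fun _ _ => rfl } with hB₂₁
    set B₂₂ : Matrix (l ⊕ l) (l ⊕ l) ℂ →L[ℝ] Matrix l l ℂ := LinearMap.toContinuousLinearMap
      { toFun := fun M => M.toBlocks₂₂, map_add' := fun _ _ => rfl, map_smul' := fun _ _ => rfl } with hB₂₂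
    have hexp : ContDiff ℝ m (fun y : E => exp (Λ y)) := by
      have h : ContDiff ℝ m (fun M : Matrix (l ⊕ l) (l ⊕ l) ℂ => exp M) :=
        contDiff_iff_contDiffAt.2 fun M => (NormedSpace.exp_analytic (𝕂 := ℝ) M).contDiffAt
      exact h.comp Λ.contDiff
    have hnum : ContDiff ℝ m (fun y : E => num (exp (Λ y)) (I • (1 : Matrix l l ℂ))) := by
      have h := ((B₁₁.contDiff.comp hexp).const_smul I).add (B₁₂.contDiff.comp hexp)
      have hfun : (fun y : E => num (exp (Λ y)) (I • (1 : Matrix l l ℂ))) =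
          fun y => I • (B₁₁ ∘ fun y => exp (Λ y)) y + (B₁₂ ∘ fun y => exp (Λ y)) y := by
        funext y; rw [num_I]; rfl
      rw [hfun]; exact h
    have hden : ContDiff ℝ m (fun y : E => denom (exp (Λ y)) (I • (1 : Matrix l l ℂ))) := by
      have h := ((B₂₁.contDiff.comp hexp).const_smul I).add (B₂₂.contDiff.comp hexp)
      have hfun : (fun y : E => denom (exp (Λ y)) (I • (1 : Matrix l l ℂ))) =
          fun y => I • (B₂₁ ∘ fun y => exp (Λ y)) y + (B₂₂ ∘ fun y => exp (Λ y)) y := by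
        funext y; rw [denom_I']; rfl
      rw [hfun]; exact h
    have hden0 : denom (exp (Λ 0)) (I • (1 : Matrix l l ℂ)) = ((1 : (Matrix l l ℂ)ˣ) : Matrix l l ℂ) := by
      rw [map_zero, NormedSpace.exp_zero, denom_one_I, Units.val_one]
    have hinv : ContDiffAt ℝ m (fun y : E => Ring.inverse (denom (exp (Λ y)) (I • (1 : Matrix l l ℂ)))) 0 := by
      have hR := contDiffAt_ringInverse ℝ (n := m) (1 : (Matrix l l ℂ)ˣ)
      rw [← hden0] at hR
      exact hR.comp 0 hden.contDiffAt
    exact (Matrix.entryLinearMap ℝ ℂ i j).toContinuousLinearMap.contDiff.contDiffAt.comp 0 (hnum.contDiffAt.mul hinv)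
  refine key.congr_of_eventuallyEq (Eventually.of_forall fun y => ?_)
  show moeb (exp (Λ y)) (I • 1) i j = _
  rw [moeb_def, Matrix.nonsing_inv_eq_ringInverse]
  rfl

/-! ## §3 The chart at a point and its strict derivative -/

/-- **Strict differentiability of the `P`-chart at the origin.**  For any `X₀ R₀ : M_n(ℂ)`, any real-linear `Λ : E → M_{2n}(ℂ)` and any
continuous linear equivalence `A : E ≃ (l → l → ℂ)` whose values are `A y = R₀ ((Λy)₁₂ + (Λy)₂₁ + i((Λy)₁₁ − (Λy)₂₂)) R₀`, the chart
`χ(y) = R₀ · moeb (exp (Λ y)) (i·1) · R₀ + X₀` (in coordinates) has strict Fréchet derivative `A` at `0`. [cite: Shimura1997, §5.6] -/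
theorem hasStrictFDerivAt_chart (X₀ R₀ : Matrix l l ℂ) (Λ : E →L[ℝ] Matrix (l ⊕ l) (l ⊕ l) ℂ) (A : E ≃L[ℝ] (l → l → ℂ))
    (hA : ∀ y : E, (A y : l → l → ℂ) = fun i j =>
      (R₀ * ((Λ y).toBlocks₁₂ + (Λ y).toBlocks₂₁ + I • ((Λ y).toBlocks₁₁ - (Λ y).toBlocks₂₂)) * R₀) i j) :
    HasStrictFDerivAt (fun y : E => fun i j => (R₀ * moeb (exp (Λ y)) (I • (1 : Matrix l l ℂ)) * R₀ + X₀) i j)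
      (A : E →L[ℝ] (l → l → ℂ)) 0 := by
  -- the raw chart `χ₀ y = moeb (exp (Λ y)) (i·1)` in coordinates, its smoothness and its derivative along lines
  set χ₀ : E → (l → l → ℂ) := fun y i j => moeb (exp (Λ y)) (I • (1 : Matrix l l ℂ)) i j with hχ₀
  have hcd : ContDiffAt ℝ 1 χ₀ 0 :=
    contDiffAt_pi.2 fun i => contDiffAt_pi.2 fun j => contDiffAt_moeb_exp_entry Λ i j
  have hstrict₀ : HasStrictFDerivAt χ₀ (fderiv ℝ χ₀ 0) 0 := hcd.hasStrictFDerivAt one_ne_zero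
  have hline : ∀ y : E, fderiv ℝ χ₀ 0 y =
      fun i j => ((Λ y).toBlocks₁₂ + (Λ y).toBlocks₂₁ + I • ((Λ y).toBlocks₁₁ - (Λ y).toBlocks₂₂)) i j := by
    intro y
    have h1 : HasDerivAt (fun t : ℝ => χ₀ (t • y)) (fderiv ℝ χ₀ 0 y) 0 := by
      have hF : HasFDerivAt χ₀ (fderiv ℝ χ₀ 0) ((fun t : ℝ => t • y) 0) := by
        have hz : (fun t : ℝ => t • y) 0 = 0 := by simp only [zero_smul]
        rw [hz]; exact hstrict₀.hasFDerivAt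
      have h := hF.comp_hasDerivAt (0 : ℝ) ((hasDerivAt_id (0 : ℝ)).smul_const y)
      rwa [one_smul] at h
    have h2 : HasDerivAt (fun t : ℝ => χ₀ (t • y))
        (fun i j => ((Λ y).toBlocks₁₂ + (Λ y).toBlocks₂₁ + I • ((Λ y).toBlocks₁₁ - (Λ y).toBlocks₂₂)) i j) 0 := by
      refine hasDerivAt_pi.2 fun i => hasDerivAt_pi.2 fun j => ?_
      have h := hasDerivAt_moeb_exp_smul_entry (Λ y) i j
      refine h.congr_of_eventuallyEq (Eventually.of_forall fun t => ?_)
      simp only [hχ₀, map_smul]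
    exact h1.unique h2
  -- the affine transport `W ↦ R₀ W R₀ + X₀`
  set T : (l → l → ℂ) →L[ℝ] (l → l → ℂ) := LinearMap.toContinuousLinearMap
    { toFun := fun W i j => (R₀ * Matrix.of W * R₀) i j
      map_add' := fun W W' => by
        funext i j
        simp only [Pi.add_apply]
        rw [show Matrix.of (W + W') = Matrix.of W + Matrix.of W' from rfl, Matrix.mul_add, Matrix.add_mul]
        rfl
      map_smul' := fun a W => by
        funext i j
        simp only [Pi.smul_apply, RingHom.id_apply]
        rw [show Matrix.of (a • W) = a • Matrix.of W from rfl, Matrix.mul_smul, Matrix.smul_mul]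
        rfl } with hT
  have hTapp : ∀ W : l → l → ℂ, T W = fun i j => (R₀ * Matrix.of W * R₀) i j := fun W => rfl
  have hcomp : (fun y : E => fun i j => (R₀ * moeb (exp (Λ y)) (I • (1 : Matrix l l ℂ)) * R₀ + X₀) i j) =
      fun y => T (χ₀ y) + fun i j => X₀ i j := by
    funext y i j
    rw [Pi.add_apply, Pi.add_apply, hTapp]
    rfl
  rw [hcomp]
  have hder : (A : E →L[ℝ] (l → l → ℂ)) = T.comp (fderiv ℝ χ₀ 0) := by
    ext y i j
    rw [ContinuousLinearMap.comp_apply, hTapp, hline y]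
    exact congrFun (congrFun (hA y) i) j
  rw [hder]
  exact (T.hasStrictFDerivAt.comp 0 hstrict₀).add_const _

/-! ## §4 The local inverse of the chart (inverse function theorem) -/

/-- **The chart is a local diffeomorphism at the origin** (★ `HasStrictFDerivAt.to_localInverse`): under the hypotheses of
`hasStrictFDerivAt_chart` and with `E` complete, there is `ψ` with `ψ (χ 0) = 0`, `χ (ψ W) = W` for `W` near `χ 0 = R₀ (i·1) R₀ + X₀`,
and `HasFDerivAt ψ A⁻¹ (χ 0)`. [folklore] -/
theorem exists_localInverse_chart [CompleteSpace E] (X₀ R₀ : Matrix l l ℂ) (Λ : E →L[ℝ] Matrix (l ⊕ l) (l ⊕ l) ℂ)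
    (A : E ≃L[ℝ] (l → l → ℂ))
    (hA : ∀ y : E, (A y : l → l → ℂ) = fun i j =>
      (R₀ * ((Λ y).toBlocks₁₂ + (Λ y).toBlocks₂₁ + I • ((Λ y).toBlocks₁₁ - (Λ y).toBlocks₂₂)) * R₀) i j) :
    ∃ ψ : (l → l → ℂ) → E,
      ψ (fun i j => (R₀ * (I • (1 : Matrix l l ℂ)) * R₀ + X₀) i j) = 0 ∧
      HasFDerivAt ψ (A.symm : (l → l → ℂ) →L[ℝ] E) (fun i j => (R₀ * (I • (1 : Matrix l l ℂ)) * R₀ + X₀) i j) ∧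
      ∀ᶠ W in 𝓝 (fun i j => (R₀ * (I • (1 : Matrix l l ℂ)) * R₀ + X₀) i j),
        (fun i j => (R₀ * moeb (exp (Λ (ψ W))) (I • (1 : Matrix l l ℂ)) * R₀ + X₀) i j) = W := by
  have hχ := hasStrictFDerivAt_chart X₀ R₀ Λ A hA
  have h0 : (fun i j => (R₀ * moeb (exp (Λ 0)) (I • (1 : Matrix l l ℂ)) * R₀ + X₀) i j : l → l → ℂ) =
      fun i j => (R₀ * (I • (1 : Matrix l l ℂ)) * R₀ + X₀) i j := by
    funext i j
    rw [map_zero, NormedSpace.exp_zero, Literature.NumberTheory.ModularForms.SiegelUpperHalfSpace.moeb_one]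
  refine ⟨hχ.localInverse _ A 0, ?_, ?_, ?_⟩
  · have h := hχ.localInverse_apply_image
    rwa [h0] at h
  · have h := hχ.to_localInverse
    rw [h0] at h
    exact h.hasFDerivAt
  · have h := hχ.eventually_right_inverse
    rwa [h0] at h

end Chart

end Summit.HodgeConjecture.HodgeConjecture.Cruxes.HLiu418.K2LiuHermitianTubePChart

end
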